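import Summits.Ventures.PackingBounds.ThreePointCert.K10d12AggG1
import Summits.Ventures.PackingBounds.ThreePointCert.K10d12AggP
import Summits.Ventures.PackingBounds.ThreePointCert.CheckKS

/-!
# κ(10) ≤ 556: kernel validation (Kronecker substitution) of Gram blocks R1, R2, R3 (131781 factor entries; part 2 of 3)

Framing: lottery ticket; floor = certified bounds/negative ranges. Venture `PackingBounds` (cell
`pub-packcert`), three-point SDP family, kissing column. Integer data / kernel checks of a feasible point of the
Bachoc–Vallentin semidefinite program (n = 10, s = 1/2, three-point matrix degree 12, two-point (Gegenbauer) part to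
degree L = 24, Bachoc–Vallentin multiplier set = cell mode sym2; exact rational certificate `sdp-n10-d12-s1-2-sym2-a24-hyb7-j143228.json`
(sha256 ec3df9a54f2f215f2d69b4ef79b85f5fd23fd5faa12cd7f670a7d0c251362865) of the sdp seat's hybrid pipeline, verified by the cell's two exact verifiers), converted by
`cert2lean_g9.py` (lp gen 9; S = 64) into the units of the kernel checker `ThreePointCert.Check` + `CheckSym2` with the
record degree field set to L = 24 (the checker's degree enters only the unit `W = 2^d·d!` and the side conditions, so a
(d, L) certificate is a `Cert3` of degree L); Gram factor COLUMNS offset-encoded for the Kronecker-substitution validation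
`ThreePointCert.CheckKS` (`sosCheckKS`: the claimed expansion and `Σ_k col_k²` compared at the point `(2^w, 2^{wD}, 2^{wD²})`); split check of (ii') `ThreePointCert.CheckSym2Split`.
Emitter `emitlean_ks.py` (lp gen 10; coarse Gram factors `L′ ≈ L/2^k`, expansions `4^k • zᵀ(L′L′ᵀ)z` lifted by `SoundNN.boxNonneg_smul` as in lp gen 9's v3s). Generated file: plain lists of integers / monomials.
-/

namespace Summit.Ventures.PackingBounds.ThreePointCert.K10d12

open Literature.Geometry.DiscreteGeometry Literature.Geometry.DiscreteGeometry.PolyCert PolyCert.SPoly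

set_option maxRecDepth 100000 in
set_option maxHeartbeats 0 in
/-- Block `R1` (multiplier g_q(u), coset-symmetrised (Bachoc–Vallentin (10))): the unscaled expansion `eR1s` IS `Σ_k col_k²` — Kronecker-substitution check at `(2^166, 2^(166·23), 2^(166·23²))` (kernel; 66430 factor entries). -/
theorem vR1 : sosCheckKS 166 23 590295810358705651712 1180591620717411303424 K10d12.zR1 K10d12.psR1 K10d12.colsR1 K10d12.eR1s = true := by
  decide +kernel

set_option maxRecDepth 100000 in
set_option maxHeartbeats 0 in
/-- Block `R2` (multiplier q²·s₂): the unscaled expansion `eR2s` IS `Σ_k col_k²` — Kronecker-substitution check at `(2^159, 2^(159·21), 2^(159·21²))` (kernel; 41041 factor entries). -/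
theorem vR2 : sosCheckKS 159 21 73786976294838206464 147573952589676412928 K10d12.zR2 K10d12.psR2 K10d12.colsR2 K10d12.eR2s = true := by
  decide +kernel

set_option maxRecDepth 100000 in
set_option maxHeartbeats 0 in
/-- Block `R3` (multiplier q³·s₃): the unscaled expansion `eR3s` IS `Σ_k col_k²` — Kronecker-substitution check at `(2^162, 2^(162·19), 2^(162·19²))` (kernel; 24310 factor entries). -/
theorem vR3 : sosCheckKS 162 19 295147905179352825856 590295810358705651712 K10d12.zR3 K10d12.psR3 K10d12.colsR3 K10d12.eR3s = true := by
  decide +kernel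

end Summit.Ventures.PackingBounds.ThreePointCert.K10d12
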